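import Mathlib

/-!
# The `4 × 4` pencil behind `LaplaceOptimal 4`: ten lines of rank `≤ 2`, and a plane is never inside them
# (crux `RankRigidMinimalRepr`, stmt-ValiantsHypothesis-18034, route `RigidityForcesSymmetry`)

Contracting two slots of the permutation pattern `P₄(v) = [v : Fin 4 → Fin 4 injective]` (`…LaplaceDefs.lean`,
`LaplaceOptimal 4`) against vectors `ψ, φ ∈ ℂ⁴` leaves the symmetric zero-diagonal `4 × 4` matrix
`Q_{ψ,φ}(z,w) = ψ_x φ_y + ψ_y φ_x` (`{x,y}` the complement of `{z,w}`); for `φ = 𝟙` this is the PENCIL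
`M(t)(z,w) = [z ≠ w] (T - t_z - t_w)`, `T = Σ t` (and `Q_{φ∘t,φ} = (Πφ) D_φ⁻¹ M(t) D_φ⁻¹` in general).  Every cheap
split-rank-one decomposition of `P₄` turns, after such a contraction, into «`M(ψ)` is a sum of few rank-one matrices
for all `ψ` in a subspace of small codimension»; this file provides the two finite facts that kill most profiles:

* `pencil_eq_zero` — `M(t) = 0` only for `t = 0`, and a symmetric zero-diagonal matrix which is ONE rank-one product is `0`;
* `pencil_ten_lines` — if `M(t)` is a sum of TWO rank-one products then `t` lies on one of TEN lines: the four «stars»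
  `ℂ·(2e_a - 𝟙)` and the six «matchings» `ℂ·(e_a - e_b)` (all `3 × 3` minors of a two-term sum vanish; the principal ones are
  `2·M_{xy}M_{xz}M_{yz}`, so the zero pattern of `M` meets every triangle of `K₄`, hence contains a triangle (star) or a
  perfect matching, and two more minors pin the matching case);
* `pencil_plane_not_ten_lines` — no `2`-dimensional family `ψ + μψ'` stays inside the ten lines (pigeonhole on eleven
  values of `μ`), packaged as `pencil_two_rank_one_plane`: «`M(ψ + μψ')` is a sum of two rank-one products for every `μ`»
  forces `ψ, ψ'` to be dependent.

Written matrix-free (explicit entries) so that later files can instantiate it with any contraction.  presearch (corpus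
fts+vec, galaxy «partition rank | set-multilinear | Laplace expansion optimal»): nothing specific (Landsberg 2017, BCS 1997
generic).  HONEST FRAMING: elementary finite linear algebra toward the exact status of `LaplaceOptimal 4` (rung
`TiedTorusBound 3` of the line `PairTiedTorusBound`); the crux stays OPEN; nothing here bears on `VP ≠ VNP`.
-/

set_option autoImplicit false

-- the mandated summit-side namespace repeats a component by design (single-problem summit)
set_option linter.dupNamespace false

namespace Summit.ValiantsHypothesis.ValiantsHypothesis.Theorems.RigidityForcesSymmetryRankRigidMinimalRepr

namespace LaplaceFourPencil

/-! ### §1 One rank-one product -/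

/-- A symmetric zero-diagonal pattern which is a single rank-one product `a_z b_w` vanishes identically:
from `a_z b_z = 0` for all `z`, `n_{zw}² = (a_z b_w)(a_w b_z) = (a_z b_z)(a_w b_w) = 0`. -/
theorem symm_rank_one_eq_zero (n : Fin 4 → Fin 4 → ℂ) (a b : Fin 4 → ℂ)
    (hsymm : ∀ z w, n z w = n w z) (hdiag : ∀ z, n z z = 0) (h : ∀ z w, n z w = a z * b w) :
    ∀ z w, n z w = 0 := by
  intro z w
  have h1 : n z w * n z w = (a z * b z) * (a w * b w) := by
    have e1 : n z w = a z * b w := h z w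
    have e2 : n z w = a w * b z := (hsymm z w).trans (h w z)
    calc n z w * n z w = (a z * b w) * (a w * b z) := by rw [← e1, ← e2]
      _ = (a z * b z) * (a w * b w) := by ring
  rw [← h z z, ← h w w, hdiag z, zero_mul] at h1
  exact mul_self_eq_zero.1 h1

/-- `M(t) = 0` forces `t = 0` (`t_x + t_y = 0` for all `x ≠ y`). Stated with the complement sums written out. -/
theorem pencil_eq_zero (t : Fin 4 → ℂ) (h01 : t 2 + t 3 = 0) (h02 : t 1 + t 3 = 0) (h12 : t 0 + t 3 = 0)
    (h03 : t 1 + t 2 = 0) : t = 0 := by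
  funext i
  fin_cases i
  · show t 0 = 0
    linear_combination h12 - (1/2 : ℂ) * (h01 - h03 + h02)
  · show t 1 = 0
    linear_combination (1/2 : ℂ) * (h02 + h03 - h01)
  · show t 2 = 0
    linear_combination (1/2 : ℂ) * (h01 + h03 - h02)
  · show t 3 = 0
    linear_combination (1/2 : ℂ) * (h01 - h03 + h02)


/-! ### §2 Two rank-one products: the ten lines -/

/-- Every `3 × 3` minor of a sum of two rank-one products vanishes (Cauchy–Binet), written out for a function `N`
with `N z w = a_z b_w + a'_z b'_w` and arbitrary row/column triples. -/
theorem det3_two_rank_one (N : Fin 4 → Fin 4 → ℂ) (a b a' b' : Fin 4 → ℂ)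
    (hN : ∀ z w, N z w = a z * b w + a' z * b' w) (r₁ r₂ r₃ c₁ c₂ c₃ : Fin 4) :
    N r₁ c₁ * (N r₂ c₂ * N r₃ c₃ - N r₂ c₃ * N r₃ c₂) - N r₁ c₂ * (N r₂ c₁ * N r₃ c₃ - N r₂ c₃ * N r₃ c₁)
      + N r₁ c₃ * (N r₂ c₁ * N r₃ c₂ - N r₂ c₂ * N r₃ c₁) = 0 := by
  simp only [hN]; ring

/-- The combinatorial core: a set of edges of `K₄` meeting all four triangles contains a perfect matching or a
triangle (Boolean form, by `decide`; `zxy` = «edge `xy` is in the set»). -/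
theorem cover_bool : ∀ z01 z02 z03 z12 z13 z23 : Bool,
    (z01 || z02 || z12) = true → (z01 || z03 || z13) = true → (z02 || z03 || z23) = true →
    (z12 || z13 || z23) = true →
    ((z01 && z23) || (z02 && z13) || (z03 && z12) || (z01 && z02 && z12) || (z01 && z03 && z13) ||
      (z02 && z03 && z23) || (z12 && z13 && z23)) = true := by
  decide

/-- The matching case `{01, 23}`: if `M(t)` is a sum of two rank-one products and `t₀ + t₁ = t₂ + t₃ = 0`
(so `t = (p, -p, q, -q)`), two non-principal minors give `pq(p - q) = pq(p + q) = 0`, hence `p = 0` or `q = 0`. -/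
theorem matching_case (t a b a' b' : Fin 4 → ℂ)
    (h : ∀ z w : Fin 4, (if z = w then (0 : ℂ) else (∑ i, t i) - t z - t w) = a z * b w + a' z * b' w)
    (hA : t 0 + t 1 = 0) (hB : t 2 + t 3 = 0) : t 0 = 0 ∨ t 2 = 0 := by
  have ht1 : t 1 = -t 0 := by linear_combination hA
  have ht3 : t 3 = -t 2 := by linear_combination hB
  have hT : ∑ i, t i = 0 := by rw [Fin.sum_univ_four]; linear_combination hA + hB
  have m1 := det3_two_rank_one (fun z w => if z = w then (0 : ℂ) else (∑ i, t i) - t z - t w) a b a' b' h 0 1 2 1 2 3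
  have m2 := det3_two_rank_one (fun z w => if z = w then (0 : ℂ) else (∑ i, t i) - t z - t w) a b a' b' h 0 1 2 0 2 3
  simp only [hT, Fin.isValue, Fin.reduceEq, ↓reduceIte, zero_sub] at m1 m2
  rw [ht1, ht3] at m1 m2
  have key : (t 0) ^ 2 * t 2 = 0 := by linear_combination (-1/8 : ℂ) * m1 + (1/8 : ℂ) * m2
  rcases mul_eq_zero.1 key with h0 | h2
  · exact Or.inl (pow_eq_zero_iff (two_ne_zero)|>.1 h0)
  · exact Or.inr h2

/-- **The ten lines.**  If the pencil matrix `M(t)(z,w) = [z ≠ w](T - t_z - t_w)`, `T = Σ t`, is a sum of two rank-one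
products, then `t` is a multiple of a «star» `2e_i - 𝟙` (`t_i = c`, `t_j = -c` for `j ≠ i`) or of a «matching»
`e_i - e_j` (`t` vanishes off `{i, j}` and `t_i + t_j = 0`). -/
theorem pencil_ten_lines (t a b a' b' : Fin 4 → ℂ)
    (h : ∀ z w : Fin 4, (if z = w then (0 : ℂ) else (∑ i, t i) - t z - t w) = a z * b w + a' z * b' w) :
    (∃ i : Fin 4, ∃ c : ℂ, ∀ j, t j = if j = i then c else -c) ∨
    (∃ i j : Fin 4, i ≠ j ∧ (∀ k, k ≠ i → k ≠ j → t k = 0) ∧ t i + t j = 0) := by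
  -- the four principal minors: products over triangles
  have hS : ∑ i, t i = t 0 + t 1 + t 2 + t 3 := Fin.sum_univ_four t
  have m3 := det3_two_rank_one (fun z w => if z = w then (0 : ℂ) else (∑ i, t i) - t z - t w) a b a' b' h 0 1 2 0 1 2
  have m2 := det3_two_rank_one (fun z w => if z = w then (0 : ℂ) else (∑ i, t i) - t z - t w) a b a' b' h 0 1 3 0 1 3
  have m1 := det3_two_rank_one (fun z w => if z = w then (0 : ℂ) else (∑ i, t i) - t z - t w) a b a' b' h 0 2 3 0 2 3
  have m0 := det3_two_rank_one (fun z w => if z = w then (0 : ℂ) else (∑ i, t i) - t z - t w) a b a' b' h 1 2 3 1 2 3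
  simp only [hS, Fin.isValue, Fin.reduceEq, ↓reduceIte] at m3 m2 m1 m0
  -- complement sums `n_{xy}`
  have p3 : (t 2 + t 3) * (t 1 + t 3) * (t 0 + t 3) = 0 := by linear_combination (1/2 : ℂ) * m3
  have p2 : (t 2 + t 3) * (t 1 + t 2) * (t 0 + t 2) = 0 := by linear_combination (1/2 : ℂ) * m2
  have p1 : (t 1 + t 3) * (t 1 + t 2) * (t 0 + t 1) = 0 := by linear_combination (1/2 : ℂ) * m1
  have p0 : (t 0 + t 3) * (t 0 + t 2) * (t 0 + t 1) = 0 := by linear_combination (1/2 : ℂ) * m0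
  -- Boolean bookkeeping
  have tob : ∀ {x y z : ℂ}, x * y * z = 0 →
      (decide (x = 0) || decide (y = 0) || decide (z = 0)) = true := by
    intro x y z hxyz
    rcases mul_eq_zero.1 hxyz with hxy | hz
    · rcases mul_eq_zero.1 hxy with hx | hy
      · simp [hx]
      · simp [hy]
    · simp [hz]
  have cov := cover_bool (decide (t 2 + t 3 = 0)) (decide (t 1 + t 3 = 0)) (decide (t 1 + t 2 = 0))
    (decide (t 0 + t 3 = 0)) (decide (t 0 + t 2 = 0)) (decide (t 0 + t 1 = 0)) (tob p3) (tob p2) (tob p1) (tob p0)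
  simp only [Bool.or_eq_true, Bool.and_eq_true, decide_eq_true_eq] at cov
  -- relabelled copies of `h` for the two other matchings
  have hsw : ∀ σ : Equiv.Perm (Fin 4), ∀ z w : Fin 4,
      (if z = w then (0 : ℂ) else (∑ i, (t ∘ σ) i) - (t ∘ σ) z - (t ∘ σ) w) =
        (a ∘ σ) z * (b ∘ σ) w + (a' ∘ σ) z * (b' ∘ σ) w := by
    intro σ z w
    have := h (σ z) (σ w)
    simp only [Function.comp_apply, EmbeddingLike.apply_eq_iff_eq] at this ⊢
    rwa [Equiv.sum_comp σ t]
  rcases cov with ((((((⟨hA, hB⟩ | ⟨hA, hB⟩) | ⟨hA, hB⟩) | ⟨⟨hA, hB⟩, hC⟩) | ⟨⟨hA, hB⟩, hC⟩) | ⟨⟨hA, hB⟩, hC⟩) | ⟨⟨hA, hB⟩, hC⟩)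
  · -- matching {01, 23}: `t₂ + t₃ = 0`, `t₀ + t₁ = 0`
    right
    rcases matching_case t a b a' b' h hB hA with h0 | h2
    · exact ⟨2, 3, by decide, fun k hk2 hk3 => by
        fin_cases k
        · exact h0
        · simpa [h0] using hB
        · exact absurd rfl hk2
        · exact absurd rfl hk3, hA⟩
    · exact ⟨0, 1, by decide, fun k hk0 hk1 => by
        fin_cases k
        · exact absurd rfl hk0
        · exact absurd rfl hk1
        · exact h2
        · simpa [h2] using hA, hB⟩
  · -- matching {02, 13}: `t₁ + t₃ = 0`, `t₀ + t₂ = 0`; relabel by the transposition (1 2)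
    right
    have h' := hsw (Equiv.swap 1 2)
    rcases matching_case (t ∘ Equiv.swap 1 2) _ _ _ _ h' (by simpa [Equiv.swap_apply_of_ne_of_ne] using hB)
      (by simpa [Equiv.swap_apply_of_ne_of_ne] using hA) with h0 | h2
    · replace h0 : t 0 = 0 := by simpa [Equiv.swap_apply_of_ne_of_ne] using h0
      exact ⟨1, 3, by decide, fun k hk hk' => by
        fin_cases k
        · exact h0
        · exact absurd rfl hk
        · simpa [h0] using hB
        · exact absurd rfl hk', hA⟩
    · replace h2 : t 1 = 0 := by simpa using h2
      exact ⟨0, 2, by decide, fun k hk hk' => by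
        fin_cases k
        · exact absurd rfl hk
        · exact h2
        · exact absurd rfl hk'
        · simpa [h2] using hA, hB⟩
  · -- matching {03, 12}: `t₁ + t₂ = 0`, `t₀ + t₃ = 0`; relabel by the transposition (1 3)
    right
    have h' := hsw (Equiv.swap 1 3)
    rcases matching_case (t ∘ Equiv.swap 1 3) _ _ _ _ h' (by simpa [Equiv.swap_apply_of_ne_of_ne] using hB)
      (by simpa [Equiv.swap_apply_of_ne_of_ne, add_comm] using hA) with h0 | h2
    · replace h0 : t 0 = 0 := by simpa [Equiv.swap_apply_of_ne_of_ne] using h0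
      exact ⟨1, 2, by decide, fun k hk hk' => by
        fin_cases k
        · exact h0
        · exact absurd rfl hk
        · exact absurd rfl hk'
        · simpa [h0] using hB, hA⟩
    · replace h2 : t 2 = 0 := by simpa [Equiv.swap_apply_of_ne_of_ne] using h2
      exact ⟨0, 3, by decide, fun k hk hk' => by
        fin_cases k
        · exact absurd rfl hk
        · simpa [h2] using hA
        · exact h2
        · exact absurd rfl hk', hB⟩
  · -- triangle omitting 3: `t₂+t₃ = t₁+t₃ = t₀+t₃ = 0`
    left
    exact ⟨3, t 3, fun j => by
      fin_cases j
      · simp; linear_combination hC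
      · simp; linear_combination hB
      · simp; linear_combination hA
      · simp⟩
  · -- triangle omitting 2: `t₂+t₃ = t₁+t₂ = t₀+t₂ = 0`
    left
    exact ⟨2, t 2, fun j => by
      fin_cases j
      · simp; linear_combination hC
      · simp; linear_combination hB
      · simp
      · simp; linear_combination hA⟩
  · -- triangle omitting 1: `t₁+t₃ = t₁+t₂ = t₀+t₁ = 0`
    left
    exact ⟨1, t 1, fun j => by
      fin_cases j
      · simp; linear_combination hC
      · simp
      · simp; linear_combination hB
      · simp; linear_combination hA⟩
  · -- triangle omitting 0: `t₀+t₃ = t₀+t₂ = t₀+t₁ = 0`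
    left
    exact ⟨0, t 0, fun j => by
      fin_cases j
      · simp
      · simp; linear_combination hC
      · simp; linear_combination hB
      · simp; linear_combination hA⟩


/-! ### §3 A plane is never inside the ten lines -/

/-- Descriptor of the ten lines: `inl i` = the star `2e_i - 𝟙`, `inr (i, j)` = the matching `e_i - e_j`. -/
theorem ten_lines_descriptor (t a b a' b' : Fin 4 → ℂ)
    (h : ∀ z w : Fin 4, (if z = w then (0 : ℂ) else (∑ i, t i) - t z - t w) = a z * b w + a' z * b' w) :
    ∃ d : Fin 4 ⊕ (Fin 4 × Fin 4), match d with
      | Sum.inl i => ∃ c : ℂ, ∀ j, t j = if j = i then c else -c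
      | Sum.inr p => p.1 ≠ p.2 ∧ (∀ k, k ≠ p.1 → k ≠ p.2 → t k = 0) ∧ t p.1 + t p.2 = 0 := by
  rcases pencil_ten_lines t a b a' b' h with ⟨i, c, hc⟩ | ⟨i, j, hij, h0, hs⟩
  · exact ⟨Sum.inl i, c, hc⟩
  · exact ⟨Sum.inr (i, j), hij, h0, hs⟩

/-- **No plane inside the ten lines.**  If `t, t'` are linearly independent, the pencil matrices `M(t + μ t')` cannot
ALL (for every `μ ∈ ℂ`) be sums of two rank-one products: by `pencil_ten_lines` each `t + μ t'` would lie on one of the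
ten lines, two of the twenty-one values `μ = 0, …, 20` would share a line, and a line through two points of the pencil
`t + μ t'` contains `t` and `t'`. -/
theorem pencil_plane_not_two_rank_one (t t' : Fin 4 → ℂ) (hind : LinearIndependent ℂ ![t, t'])
    (h : ∀ μ : ℂ, ∃ a b a' b' : Fin 4 → ℂ, ∀ z w : Fin 4,
      (if z = w then (0 : ℂ) else (∑ i, (t + μ • t') i) - (t + μ • t') z - (t + μ • t') w) =
        a z * b w + a' z * b' w) : False := by
  rw [LinearIndependent.pair_iff] at hind
  have hdesc : ∀ k : Fin 21, ∃ d : Fin 4 ⊕ (Fin 4 × Fin 4), match d with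
      | Sum.inl i => ∃ c : ℂ, ∀ j, (t + ((k : ℕ) : ℂ) • t') j = if j = i then c else -c
      | Sum.inr p => p.1 ≠ p.2 ∧ (∀ l, l ≠ p.1 → l ≠ p.2 → (t + ((k : ℕ) : ℂ) • t') l = 0) ∧
          (t + ((k : ℕ) : ℂ) • t') p.1 + (t + ((k : ℕ) : ℂ) • t') p.2 = 0 := by
    intro k
    obtain ⟨a, b, a', b', hk⟩ := h ((k : ℕ) : ℂ)
    exact ten_lines_descriptor _ a b a' b' hk
  choose f hf using hdesc
  obtain ⟨k₁, k₂, hne, heq⟩ := Fintype.exists_ne_map_eq_of_card_lt f (by simp)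
  have hμ : ((k₁ : ℕ) : ℂ) ≠ ((k₂ : ℕ) : ℂ) := by
    intro e
    exact hne (Fin.ext (by exact_mod_cast e))
  set μ₁ : ℂ := ((k₁ : ℕ) : ℂ) with hμ₁
  set μ₂ : ℂ := ((k₂ : ℕ) : ℂ) with hμ₂
  have h1 := hf k₁
  have h2 := hf k₂
  rw [heq] at h1
  -- a common line forces a non-trivial linear relation between `t` and `t'`
  have relation : ∀ c₁ c₂ : ℂ, (∀ j, c₂ * (t + μ₁ • t') j - c₁ * (t + μ₂ • t') j = 0) →
      c₁ = c₂ ∧ c₁ = 0 := by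
    intro c₁ c₂ hrel
    have hv : (c₂ - c₁) • t + (c₂ * μ₁ - c₁ * μ₂) • t' = 0 := by
      funext j
      have := hrel j
      simp only [Pi.add_apply, Pi.smul_apply, smul_eq_mul, Pi.zero_apply] at this ⊢
      linear_combination this
    obtain ⟨e1, e2⟩ := hind _ _ hv
    have hc : c₁ = c₂ := by linear_combination -e1
    refine ⟨hc, ?_⟩
    rw [hc] at e2
    have : c₂ * (μ₁ - μ₂) = 0 := by linear_combination e2
    rcases mul_eq_zero.1 this with h0 | h0
    · rw [hc, h0]
    · exact absurd (sub_eq_zero.1 h0) hμ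
  have vanish : (∀ j, (t + μ₁ • t') j = 0) → False := by
    intro hv
    have : (1 : ℂ) • t + μ₁ • t' = 0 := by
      funext j; simpa using hv j
    exact one_ne_zero (hind _ _ this).1
  rcases hd : f k₂ with i | ⟨i, j⟩
  · rw [hd] at h1 h2
    obtain ⟨c₁, hc₁⟩ := h1
    obtain ⟨c₂, hc₂⟩ := h2
    obtain ⟨hc, hc0⟩ := relation c₁ c₂ (fun j => by
      rw [hc₁ j, hc₂ j]; split_ifs <;> ring)
    exact vanish fun j => by rw [hc₁ j, hc0]; simp
  · rw [hd] at h1 h2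
    obtain ⟨hij, hz₁, hs₁⟩ := h1
    obtain ⟨-, hz₂, hs₂⟩ := h2
    simp only at hij hz₁ hs₁ hz₂ hs₂
    obtain ⟨hc, hc0⟩ := relation ((t + μ₁ • t') i) ((t + μ₂ • t') i) (fun l => by
      by_cases hli : l = i
      · subst hli; ring
      by_cases hlj : l = j
      · subst hlj
        have e1 : (t + μ₁ • t') l = -(t + μ₁ • t') i := by linear_combination hs₁
        have e2 : (t + μ₂ • t') l = -(t + μ₂ • t') i := by linear_combination hs₂
        rw [e1, e2]; ring
      · rw [hz₁ l hli hlj, hz₂ l hli hlj]; ring)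
    exact vanish fun l => by
      by_cases hli : l = i
      · subst hli; exact hc0
      by_cases hlj : l = j
      · subst hlj; linear_combination hs₁ - hc0
      · exact hz₁ l hli hlj

end LaplaceFourPencil

end Summit.ValiantsHypothesis.ValiantsHypothesis.Theorems.RigidityForcesSymmetryRankRigidMinimalRepr
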